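import Summits.AnomalousDissipation.AnomalousDissipation.Theorems.SolenoidalFractalHomogenisationLagrangianCarrierConstructionRegularLWindowDistortion
import Summits.AnomalousDissipation.AnomalousDissipation.Theorems.SolenoidalFractalHomogenisationLagrangianCarrierConstructionRegularLLevelBounds
import Literature.Analysis.FluidPDE.LagrangianLatticeCarrierFrame
import Literature.Analysis.FunctionSpaces.TorusEnstrophyOrthogonality

/-!
# K1L_D (stmt-AnomalousDissipation-27980), glue v2 / L5-0: the gradient of the coarse drift `b_{≤m}` is `O(Σ_{i≤m} a_i)` under the
# strain-budget ceiling — the `hrate` input `Cb` of `FrameForm.isModulation_frameG_of` (helper, `--supports 27980 --as helper`)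

prover ad-k1loc-p3 g8 (companion of `…LagrangianStepFrameNearIdentity`, the `hnear` input).  From the K3L distortion tower
(`…RegularLDistortion.distortion_tower`: uniform window distortion `≤ 1/10` and curvature `3Lθ₀N_i²` of the flows) and the level Lipschitz
bound `…RegularLLevelBounds.norm_lift_b_succ_sub_le_of_distortion` (`|∇b_{i+1}| ≲ a_{i+1}`, Armstrong–Vicol §2.2 p. 18), for every design `W`
there are `θs > 0` and `C' ≥ 0` (depending on `k, W`) such that for every `LPermissible`, `Regular` carrier of design `W` with `N_m² ≤ N_{m+1}`
and the template (T4) at `θ₀ ≤ θs`: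
* `norm_lift_partialSum_sub_le` — `‖b_{≤m}(t, proj z) − b_{≤m}(t, proj z')‖ ≤ C'·(Σ_{i<m} a (i+1))·‖z − z'‖` (all `t`);
* `abs_partialDeriv_partialSum_le` — `|∂_q (b_{≤m})_a (t, x)| ≤ C'·(Σ_{i<m} a (i+1))` (all `t, x, a, q`).
With `(Σ a_i)·refresh (m+1) = strain m` this is the `Cb` of `isModulation_frameG_of` (p695470) with `Cb·(t − s) ≤ C'·strain m`.
No sorry, no definition, no named fact.  NOT a proof of (V_mod), of `stub_cellInputs`, of K1L_D or of AD; rung F-D1.A0.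
-/

set_option linter.dupNamespace false

noncomputable section

namespace Summit.AnomalousDissipation.AnomalousDissipation.Theorems.SolenoidalFractalHomogenisation.LagrangianStep.FrameForm

open Set Function Filter
open scoped NNReal
open Literature.Analysis Literature.Analysis.ODE Literature.Analysis.FunctionSpaces Literature.Analysis.FunctionSpaces.Torus
open Literature.Analysis.FluidPDE Literature.Analysis.FluidPDE.LatticeShear
open Summit.AnomalousDissipation.AnomalousDissipation.Theorems.SolenoidalFractalHomogenisation.LagrangianCarrierConstruction
open Summit.AnomalousDissipation.AnomalousDissipation.Theorems.SolenoidalFractalHomogenisation.LagrangianCarrier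

variable {k : ℕ}

/-- **The coarse drift is `C'·(Σ a_i)`-Lipschitz (lifted form) under the ceiling.**  [cite: ArmstrongVicol2025, §2.2 (PDF p. 18: |∇b_m| ≲ Σ a_i) and §5.1] -/
theorem norm_lift_partialSum_sub_le (k : ℕ) (W : LatticeWord k) : ∃ θs : ℝ, 0 < θs ∧ ∃ C' : ℝ, 0 ≤ C' ∧
    ∀ (E : LagrangianLatticeCarrier k) (θ₀ : ℝ), E.design = W → θ₀ ≤ θs → E.LPermissible → E.Regular →
      (∀ m, E.N m ^ 2 ≤ E.N (m + 1)) → (∀ m, E.θ (m + 1) * ((E.N (m + 1) : ℝ) / E.N m) ^ (1 / 16 : ℝ) ≤ θ₀) →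
      ∀ (m : ℕ) (t : ℝ) (z z' : EuclideanSpace ℝ (Fin 3)),
        ‖E.partialSum m t (proj z) - E.partialSum m t (proj z')‖ ≤ C' * (∑ i ∈ Finset.range m, E.a (i + 1)) * ‖z - z'‖ := by
  obtain ⟨L, hL0, hL2W⟩ := exists_levelHessianConst W
  set M : ℝ := Real.sqrt 3 * (3 * (k : ℝ)) with hM
  set U : ℝ := (k : ℝ) / (2 * Real.pi) with hU
  have hM0 : 0 ≤ M := by positivity
  have hU0 : 0 ≤ U := by positivity
  refine ⟨min 1 (min (1 / (60 * M + 1)) (1 / (66 * (L * U) + 1))), lt_min one_pos (lt_min (by positivity) (by positivity)),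
    (11 / 10) * (3 * L * ((k : ℝ) / (2 * Real.pi)) + (11 / 10) * M), by positivity, ?_⟩
  intro E θ₀ hD hθs hLP hReg hsq hT4 m t z z'
  have hP := hLP.permissible
  have hLag := hLP.isLagrangian
  have hLR := hReg.levelRegular
  have hN0 : E.N 0 = 1 := hP.1
  have hN2 : ∀ m, 2 * E.N m ≤ E.N (m + 1) := hP.2.2.1
  have hNpos : ∀ m, (0 : ℝ) < E.N m := fun m => by exact_mod_cast E.toFractalCarrierData.N_pos m
  have hNmono : ∀ m, (E.N m : ℝ) ≤ E.N (m + 1) := fun m => by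
    have h : (2 : ℝ) * E.N m ≤ E.N (m + 1) := by exact_mod_cast hN2 m
    linarith [hNpos m]
  have hθ : ∀ m, E.θ (m + 1) ≤ θ₀ := fun m => by
    have hr : (1 : ℝ) ≤ ((E.N (m + 1) : ℝ) / E.N m) ^ (1 / 16 : ℝ) :=
      Real.one_le_rpow ((one_le_div (hNpos m)).2 (hNmono m)) (by norm_num)
    calc E.θ (m + 1) = E.θ (m + 1) * 1 := (mul_one _).symm
      _ ≤ E.θ (m + 1) * ((E.N (m + 1) : ℝ) / E.N m) ^ (1 / 16 : ℝ) := mul_le_mul_of_nonneg_left hr (E.θ_pos _).le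
      _ ≤ θ₀ := hT4 m
  have hθ0 : 0 < θ₀ := (E.θ_pos 1).trans_le (hθ 0)
  have hθ1 : θ₀ ≤ 1 := hθs.trans (min_le_left _ _)
  have hθM : 60 * (M * θ₀) ≤ 1 := by
    have h : θ₀ ≤ 1 / (60 * M + 1) := hθs.trans ((min_le_right _ _).trans (min_le_left _ _))
    rw [le_div_iff₀ (by positivity)] at h
    nlinarith
  have hθL : 66 * (L * U * θ₀) ≤ 1 := by
    have h : θ₀ ≤ 1 / (66 * (L * U) + 1) := hθs.trans ((min_le_right _ _).trans (min_le_right _ _))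
    rw [le_div_iff₀ (by positivity)] at h
    nlinarith [mul_nonneg hL0 hU0]
  have tower := distortion_tower E θ₀ hLag hLR.continuous_uncurry_b hLR.isSmooth_b hLR.exists_norm_iteratedFDeriv_b_le
    hLR.continuous_disp hLR.isSmooth_disp hLP.refresh_nested hLP.strain_le hθ hN0 hN2 hsq hL0 (hL2W E.toFractalCarrierData hD)
    hθ1 (by rw [hM] at hθM; simpa [mul_assoc] using hθM) (by simpa [hU, mul_assoc] using hθL)
  -- per level `i`: window distortion ≤ 1/10, curvature ≤ 3Lθ₀N_i², hence the level Lipschitz bound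
  have hlevel : ∀ i : ℕ, ‖E.b (i + 1) t (proj z) - E.b (i + 1) t (proj z')‖ ≤
      ((11 / 10) * (3 * L * ((k : ℝ) / (2 * Real.pi)) + (11 / 10) * M)) * E.a (i + 1) * ‖z - z'‖ := by
    intro i
    have hΓ0 : 0 ≤ 3 * L * θ₀ * (E.N i : ℝ) ^ 2 := by positivity
    have hδ : ∀ (j : ℤ) (s t : ℝ), s ∈ E.window (i + 1) j → t ∈ E.window (i + 1) j → ∀ w,
        ‖fderiv ℝ (evolutionMap (fun t (w : EuclideanSpace ℝ (Fin 3)) => E.partialSum i t (proj w)) s t) w -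
          ContinuousLinearMap.id ℝ (EuclideanSpace ℝ (Fin 3))‖ ≤ 1 / 10 :=
      fun j s t hs ht w => (tower i j s t hs ht).2.1 w
    have hΓ : ∀ (j : ℤ), ∀ t ∈ E.window (i + 1) j, ∀ w w',
        ‖fderiv ℝ (evolutionMap (fun t (w : EuclideanSpace ℝ (Fin 3)) => E.partialSum i t (proj w)) ((j : ℝ) * E.refresh (i + 1)) t) w -
          fderiv ℝ (evolutionMap (fun t (w : EuclideanSpace ℝ (Fin 3)) => E.partialSum i t (proj w)) ((j : ℝ) * E.refresh (i + 1)) t) w'‖ ≤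
          (3 * L * θ₀ * (E.N i : ℝ) ^ 2) * ‖w - w'‖ :=
      fun j t ht w w' => (tower i j _ t (left_mem_window E (i + 1) j) ht).2.2 w w'
    have h := norm_lift_b_succ_sub_le_of_distortion E i hLag hLR.continuous_uncurry_b hLR.isSmooth_b
      hLR.exists_norm_iteratedFDeriv_b_le hLR.continuous_disp hLR.isSmooth_disp hΓ0 hδ hΓ t z z'
    refine h.trans (mul_le_mul_of_nonneg_right ?_ (norm_nonneg _))
    -- the constant: `(11/10)(Γ k a/(2πN_{i+1}) + (11/10) M a) ≤ C'·a` using `N_i² ≤ N_{i+1}`, `θ₀ ≤ 1`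
    have ha : 0 < E.a (i + 1) := E.toFractalCarrierData.a_pos (i + 1)
    have hNi : (E.N i : ℝ) ^ 2 ≤ E.N (i + 1) := by exact_mod_cast hsq i
    have hfrac : 3 * L * θ₀ * (E.N i : ℝ) ^ 2 * ((k : ℝ) * E.a (i + 1) / (2 * Real.pi * E.N (i + 1)))
        ≤ 3 * L * ((k : ℝ) / (2 * Real.pi)) * E.a (i + 1) := by
      rw [show 3 * L * θ₀ * (E.N i : ℝ) ^ 2 * ((k : ℝ) * E.a (i + 1) / (2 * Real.pi * E.N (i + 1)))
          = 3 * L * ((k : ℝ) / (2 * Real.pi)) * E.a (i + 1) * (θ₀ * ((E.N i : ℝ) ^ 2 / E.N (i + 1))) by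
            field_simp]
      have h1 : θ₀ * ((E.N i : ℝ) ^ 2 / E.N (i + 1)) ≤ 1 := by
        have h2 : (E.N i : ℝ) ^ 2 / E.N (i + 1) ≤ 1 := (div_le_one (hNpos _)).2 hNi
        have h3 : 0 ≤ (E.N i : ℝ) ^ 2 / E.N (i + 1) := by positivity
        nlinarith
      have h4 : 0 ≤ 3 * L * ((k : ℝ) / (2 * Real.pi)) * E.a (i + 1) := by positivity
      nlinarith
    have hM' : Real.sqrt 3 * (3 * ((k : ℝ) * E.a (i + 1))) = M * E.a (i + 1) := by rw [hM]; ring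
    rw [hM']
    nlinarith [mul_nonneg hM0 ha.le]
  -- sum over the levels
  have hsum : E.partialSum m t (proj z) - E.partialSum m t (proj z') =
      ∑ i ∈ Finset.range m, (E.b (i + 1) t (proj z) - E.b (i + 1) t (proj z')) := by
    simp only [LagrangianLatticeCarrier.partialSum, Finset.sum_sub_distrib]
  rw [hsum]
  calc ‖∑ i ∈ Finset.range m, (E.b (i + 1) t (proj z) - E.b (i + 1) t (proj z'))‖
      ≤ ∑ i ∈ Finset.range m, ‖E.b (i + 1) t (proj z) - E.b (i + 1) t (proj z')‖ := norm_sum_le _ _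
    _ ≤ ∑ i ∈ Finset.range m, ((11 / 10) * (3 * L * ((k : ℝ) / (2 * Real.pi)) + (11 / 10) * M)) * E.a (i + 1) * ‖z - z'‖ :=
        Finset.sum_le_sum fun i _ => hlevel i
    _ = (11 / 10) * (3 * L * ((k : ℝ) / (2 * Real.pi)) + (11 / 10) * M) * (∑ i ∈ Finset.range m, E.a (i + 1)) * ‖z - z'‖ := by
        rw [Finset.mul_sum, Finset.sum_mul]

/-- **The gradient of the coarse drift is `O(Σ a_i)`**: `|∂_q (b_{≤m})_a (t, x)| ≤ C'·Σ_{i<m} a (i+1)` under the ceiling — the `Cb` of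
`FrameForm.isModulation_frameG_of`'s `hrate` (there evaluated at `x = X_m(s+u, s) y`). [cite: ArmstrongVicol2025, §2.2 (PDF p. 18)] -/
theorem abs_partialDeriv_partialSum_le (k : ℕ) (W : LatticeWord k) : ∃ θs : ℝ, 0 < θs ∧ ∃ C' : ℝ, 0 ≤ C' ∧
    ∀ (E : LagrangianLatticeCarrier k) (θ₀ : ℝ), E.design = W → θ₀ ≤ θs → E.LPermissible → E.Regular →
      (∀ m, E.N m ^ 2 ≤ E.N (m + 1)) → (∀ m, E.θ (m + 1) * ((E.N (m + 1) : ℝ) / E.N m) ^ (1 / 16 : ℝ) ≤ θ₀) →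
      ∀ (m : ℕ) (t : ℝ) (x : UnitAddTorus (Fin 3)) (a q : Fin 3),
        |Torus.partialDeriv q (fun z => E.partialSum m t z a) x| ≤ C' * ∑ i ∈ Finset.range m, E.a (i + 1) := by
  obtain ⟨θs, hθs, C', hC', H⟩ := norm_lift_partialSum_sub_le k W
  refine ⟨θs, hθs, C', hC', fun E θ₀ hD hθ hLP hReg hsq hT4 m t x a q => ?_⟩
  have hLR := hReg.levelRegular
  have hS : 0 ≤ ∑ i ∈ Finset.range m, E.a (i + 1) := Finset.sum_nonneg fun i _ => (E.toFractalCarrierData.a_pos _).le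
  -- the lift of `b_{≤m}(t, ·)` is Lipschitz with constant `C'·S_m`
  have hlip : LipschitzWith (Real.toNNReal (C' * ∑ i ∈ Finset.range m, E.a (i + 1))) (Torus.lift (E.partialSum m t)) := by
    refine LipschitzWith.of_dist_le_mul fun z z' => ?_
    rw [dist_eq_norm, dist_eq_norm, Torus.lift_apply, Torus.lift_apply, Real.coe_toNNReal _ (mul_nonneg hC' hS)]
    exact H E θ₀ hD hθ hLP hReg hsq hT4 m t z z'
  have h1 : IsContDiff 1 (E.partialSum m t) := (hLR.isSmooth_partialSum m t).isContDiff (by simp)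
  rw [partialDeriv_apply_coord h1, partialDeriv_eq_fderiv_apply h1, ← proj_repr x, ← fderiv_lift]
  have hn := norm_fderiv_le_of_lipschitz ℝ (x₀ := repr x) hlip
  rw [Real.coe_toNNReal _ (mul_nonneg hC' hS)] at hn
  calc |(fderiv ℝ (Torus.lift (E.partialSum m t)) (repr x)) (EuclideanSpace.single q (1 : ℝ)) a|
      ≤ ‖(fderiv ℝ (Torus.lift (E.partialSum m t)) (repr x)) (EuclideanSpace.single q (1 : ℝ))‖ := by
        simpa only [Real.norm_eq_abs] using
          PiLp.norm_apply_le ((fderiv ℝ (Torus.lift (E.partialSum m t)) (repr x)) (EuclideanSpace.single q (1 : ℝ))) a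
    _ ≤ ‖fderiv ℝ (Torus.lift (E.partialSum m t)) (repr x)‖ * ‖(EuclideanSpace.single q (1 : ℝ) : EuclideanSpace ℝ (Fin 3))‖ :=
        ContinuousLinearMap.le_opNorm _ _
    _ ≤ C' * ∑ i ∈ Finset.range m, E.a (i + 1) := by
        rw [PiLp.norm_single, norm_one, mul_one]; exact hn

end Summit.AnomalousDissipation.AnomalousDissipation.Theorems.SolenoidalFractalHomogenisation.LagrangianStep.FrameForm

end
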